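import Summits.QuantumFields.BalabanUV.Beta.WardLocusCombSecondOrder
import Summits.QuantumFields.BalabanUV.Beta.WardLocusQuarticTableSlot
import Summits.QuantumFields.BalabanUV.Beta.SymWardLettersAn1
import Summits.QuantumFields.BalabanUV.Beta.SymSecondOrderTablesAn1
import Summits.QuantumFields.BalabanUV.Beta.SymTablesAn1FirstOrder
import Summits.QuantumFields.BalabanUV.Beta.SymAveragingWardRootedStencils
import Summits.QuantumFields.BalabanUV.Beta.SymmetrisedStepJetsParity
import Summits.QuantumFields.BalabanUV.Beta.LagrangeFoldComb
import Summits.QuantumFields.BalabanUV.Beta.WilsonWardColourFree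
import Summits.QuantumFields.BalabanUV.Beta.WardLocusWilsonEnd
import Summits.QuantumFields.BalabanUV.Beta.BubbleParity
import Summits.QuantumFields.BalabanUV.Beta.SpineRecursiveParity
import Summits.QuantumFields.BalabanUV.Beta.KernelWardRemainderParity
import Summits.QuantumFields.BalabanUV.Beta.GAN24.CombPinLockScalar
import Summits.QuantumFields.BalabanUV.Beta.GAN24.HalfMemberSlavedDivergence

/-!
# `BalabanUV.Beta.GAN24.CombTableLawsAtPin` — binder row G-an2-4 ∕ (CONV-C), TRANSFER-III (the (α-0) chain at row D1's literal of record (III′)):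
# **THE PIN TWIN — THE TABLE LAWS OF THE T₂ RECURSION AT THE COMB-CHART RESOLVENTS `GcombSh` AND THEIR PARITIES ARE THEOREMS AT an1's RECORD
# `symTablesAn1S2 3 Lc cΛ` UNDER THE PINS** — the displayed class «(a) the table laws + parities at `GcombSh` (an2's slot-generic laws; PIN twin NOT typed)» of
# the OWNER gan24-p1 g49's (III′) END JUNCTION `CombTowerEndOfLetterRows` (and of leaf-01 g82's `CombSlavedDivRowsAtRecord`) DISCHARGED: the (III′) twin of
# leaf-03 g69's (E) FILE 5′ `SlavedDivRowsAtPin` §1 ⨾ leaf-01 g72's `HalfMemberSlavedDivergencePin` (G-an2-4 CRUX TEAM (2), leaf prover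
# `b2b-balaban-gan24-formalise-leaf-01`, gen 83 — crew GAN's kept leaf prover; no existing file touched)

NOT IN PRINT; OUR BOOKKEEPING ([folklore] composition BY NAME at weight 0; 0 `def`, 0 cited facts, 0 `def … : Prop`, 0 sorry).  HONEST FRAMING (cell contract,
verbatim): «discharging `BetaPertH` makes Bałaban's UV stability UNCONDITIONAL — a real constructive-QFT result; it is NOT the continuum limit and NOT the Clay
problem.»  HONEST DEPENDENCY (verbatim): «continuum YM on T⁴ ⇐ BetaPertH ∧ nine spine estimates (0/9 proved); BetaPertH ⇐ (D1) ∧ (D4) ∧ CAP+tail; G-an2-4 gates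
asym, D1 and NE2/3/4.»

WHAT (`d = 3`, `Lc` odd, colour `SU(N)` with `2 ≤ N`, `tabs := symTablesAn1S2 3 Lc cΛ` — an1's CLOSED (0.4) table record with the SAME `cΛ` in the Λ-slot (the order-one
consistency (c1)′ wants it), the pins `cΛ·Lc⁴ = 2`, `cE = Lc^{3+1}`, `cVH = −Lc^{3+1}·½·Lc^{3+1}`, `cE₂ = Lc⁸`, `cB = −Lc¹²∕4`, `Tc = (8N²)⁻¹ • wsym22 N`, generator scale
`ξ = ½`, root `ρ_c = toSite (ctrOff 4 Lc)`, lock constants `cH l := (stepScale 3 Lc l · Lc^{3+1})⁻¹`; `T̃′_l := T2RecOf 3 Lc (GcombSh Lc) (SpureCombOf tabs cE cVH cΛ) tabs.M cE₂ cB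
Tc tabs.vh₂S tabs.mixFF l`, `S̃′_l := SpureCombOf tabs cE cVH cΛ l`, `X_Y := diagK (½ • Σ_{v∈box} legInd ρ_c (Lc•Y+v))`):
**`exists_tableLaws_parities_comb_three_at_pin`** — `∃ R R″`, for every level `l`, coarse site `Y` and bond: (hTL) `cH l • Σ_v divV (κu ↦ T̃′_l κ u κ′ u′) (Lc•Y+v) =
[S̃′_l κ′ u′, X_Y] + R l Y κ′ u′`, (hTL″) the second-slot twin with `R″`, (hCm) the commutator word is EVEN (`trK = sgnK`), (hR)(hR″) the residual words are ODD
(`trK = −sgnK`) — EXACTLY the binders `hTL hTL'' hCm hR hR''` of `CombTowerEndOfLetterRows.exists_allScalesSeq_JsB12CombShSym_an1_of_letterRows` ∕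
`CombSlavedDivRowsAtRecord.exists_slavedDivRows_evenMember_comb_three_of_tableLaws(_sRows)` at `r := ctrOff 4 Lc`, `ξ := ½`, `cH l := (stepScale 3 Lc l · Lc^{3+1})⁻¹`
(whose scalar rows `hcH0 ∕ hcH ∕ hq` are then `CombPinLockScalar.hcH0∕hcH∕hq_pin_three` BY NAME).
HOW (every input a tree theorem; the (E) text of `SlavedDivRowsAtPin` §1 with the slot-generic laws in place of D1's): the all-levels second-order Ward KERNEL law of
`WcombOf tabs` with its residual tower `Nr` (uniform class, parity-odd rows) = an2 g36's `WardLocusCombSecondOrder.exists_kernelLaws_WcombOf_of_letters` fed with (V-d)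
(`divV_symVhSAt_eq_conjV_ctr` ⨾ `hVd_iff`), (c1)′ (`LagrangeFoldComb.dM_SpureCombOf_M1Of_eq_vertexOfK_ScombOf`), (Sp)(Mp) (`trK_SpureRecOf` ⨾ `trK_symVhSAt`∕`trK_symHessFFAt`,
`trK_M1Of`), (T2-W) (`WilsonWardColourFree.hWil_wilson_TW₃_su`∕`''`, `RW = RW″ = 0`) and an1 g43's hW letter block `SymWardLettersAn1` ((T2-B)×4 at lockB with
`RB = RB″ = 0`, (T2-M₂) with `RM := symRMAn1 Lc cΛ`, classes, parities — UNCONDITIONAL at the two locks); then an2 g29's slot-generic TABLE laws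
`WardLocusQuarticTableSlot.tableLaw_T2RecOf_zero∕''` (Wilson + border letters) and `tableLaw_T2RecOf_succ∕''` (level `m+1` from the level-`m` kernel law, the lock
`CombPinLockScalar.lock_pin_three`, the border letter) at `G := GcombSh Lc` with EVERY resolvent socket a theorem (`relInv_coDressKAt_Gsym_bhKStepSh`, `spr_bhKStepSh ⨾ spr_Dsh`,
`spr_axEc`, `comp_axEc_diagK_comm`, `divV_dM_SpureCombOf_eq_conjV`); the residual words are READ OFF the laws (`R := law's left side − commutator word`), so (hTL)(hTL″)
are identities and the parities are `parityOdd_sandwich` (`trK_GcombSh`, the class and parity of `Nr`) ⨾ `parityOdd_mmRead ⨾ _sum ⨾ _smul ⨾ _add` at level `m+1`,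
`parityOdd_zero` at level `0`; (hCm) is `parityEven_comm_of_oddRows` on (Sp).
WHAT THIS IS NOT.  Asserts NO value of Bałaban's tables and NO value of any charge; discharges NO S-slot row and NOTHING of (C)^{ev} ∕ (C)sym ∕ (Q-L) ∕ `hcell` — after this
file the (III′) END displays (b) the S-slot rows (or road-P2's six contact letters) and (d) the (C)^{ev} row, nothing of (a)∕(c); the (III′) campaign is NOT asked (an2
W-4 l.64553) — zero weight; NEVER «G-an2-4 closed» as (CONV-C); NOT D1, NOT `BetaPertH`, NOT continuum, NOT Clay; not in print.  2026-08-26.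
-/

noncomputable section

open Finset
open scoped BigOperators
open Literature.MathematicalPhysics.QuantumFieldTheory
open Literature.MathematicalPhysics.QuantumFieldTheory.Balaban1983to89
open Literature.MathematicalPhysics.QuantumFieldTheory.Balaban1983to89.Beta
open ExpKernelCalculus (MKer comp VertexFamily)
open OneStepResolventKernel (Fib LocStencil)
open OneStepKernelFamily (vertexOfK)
open AveragingContoursRooted (ctr ctrOff ctrOff_mem_box)
open WilsonVertex2Sym (wsym22)
open AffineAveraging (box toSite)
open KernelWard (divV divW)
open BalabanStepJetsSucc (mmRead wE wVH)
open BalabanStepW2 (M2Of wV4 wB2)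
open SecondOrderResponse (dM)
open Summit.QuantumFields.BalabanUV.Beta.TameKernelCalculus (trK Loc Spr)
open Summit.QuantumFields.BalabanUV.Beta.BorderedHessian (sgnK bhK stepScale diagK comp_axEc_diagK_comm)
open Summit.QuantumFields.BalabanUV.Beta.ChartConjugation (conjV)
open Summit.QuantumFields.BalabanUV.Beta.AveragingWardRootedStencils (legInd)
open Summit.QuantumFields.BalabanUV.Beta.AxialDressingRooted (one_le_of_neZero axEc spr_axEc)
open Summit.QuantumFields.BalabanUV.Beta.SpineRooted (T2RecOf SpureRecOf M1Of)
open Summit.QuantumFields.BalabanUV.Beta.SymShiftedSpread (bhKStepSh spr_bhKStepSh)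
open Summit.QuantumFields.BalabanUV.Beta.DshAn1 (Dsh spr_Dsh hVd_iff)
open Summit.QuantumFields.BalabanUV.Beta.CombChartStepJets (GcombSh decays_GcombSh ScombOf SpureCombOf SpureCombOf_eq WcombOf)
open Summit.QuantumFields.BalabanUV.Beta.SymSecondOrderTablesAn1 (symTablesAn1S2)
open Summit.QuantumFields.BalabanUV.Beta.SymTablesAn1FirstOrder (trK_symVhSAt trK_symHessFFAt)
open Summit.QuantumFields.BalabanUV.Beta.SymAveragingWardRootedStencils (divV_symVhSAt_eq_conjV_ctr)
open Summit.QuantumFields.BalabanUV.Beta.SymmetrisedStepJetsParity (trK_SpureRecOf trK_M1Of)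
open Summit.QuantumFields.BalabanUV.Beta.LagrangeFoldComb (dM_SpureCombOf_M1Of_eq_vertexOfK_ScombOf)
open Summit.QuantumFields.BalabanUV.Beta.WilsonWardColourFree (hWil_wilson_TW₃_su hWil''_wilson_TW₃_su)
open Summit.QuantumFields.BalabanUV.Beta.WardLocusWilsonEnd (locStencil_zero_apply)
open Summit.QuantumFields.BalabanUV.Beta.SymWardLettersAn1 (symRMAn1 hcls_sym hRBp_zero hRMp_sym_of_lock hBord0_sym hBord0''_sym hBordS_sym hBordS''_sym hM₂_sym)
open Summit.QuantumFields.BalabanUV.Beta.RelInvCombShiftedSpread (relInv_coDressKAt_Gsym_bhKStepSh)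
open Summit.QuantumFields.BalabanUV.Beta.CombChartWardSockets (trK_GcombSh)
open Summit.QuantumFields.BalabanUV.Beta.WardLocusCombSockets (divV_dM_SpureCombOf_eq_conjV)
open Summit.QuantumFields.BalabanUV.Beta.WardLocusCombSecondOrder (exists_kernelLaws_WcombOf_of_letters)
open Summit.QuantumFields.BalabanUV.Beta.WardLocusQuarticTableSlot (tableLaw_T2RecOf_succ tableLaw_T2RecOf_succ'' tableLaw_T2RecOf_zero tableLaw_T2RecOf_zero'')
open Summit.QuantumFields.BalabanUV.Beta.BubbleParity (spr_of_decays)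
open Summit.QuantumFields.BalabanUV.Beta.KernelWardRemainderParity (parityOdd_add)
open Summit.QuantumFields.BalabanUV.Beta.SpineRecursiveParity (parityOdd_smul parityOdd_sum parityOdd_mmRead parityOdd_sandwich parityOdd_zero)
open Summit.QuantumFields.BalabanUV.Beta.GAN24.CombPinLockScalar (lock_pin_three)
open Summit.QuantumFields.BalabanUV.Beta.GAN24.HalfMemberSlavedDivergence (parityEven_comm_of_oddRows)

namespace Summit.QuantumFields.BalabanUV.Beta.GAN24.CombTableLawsAtPin

variable {Lc : ℕ} [NeZero Lc]

/-! ## §1 The table laws of the T₂ recursion at `GcombSh` and their parities — theorems at an1's record under the pins -/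

/-- NOT IN PRINT; OUR BOOKKEEPING.  **THE PIN TWIN AT (III′): THE TABLE LAWS `hTL ∕ hTL″` OF `T̃′_l` AGAINST `[S̃′_l, X_Y]`, THE COMMUTATOR WORD EVEN, THE RESIDUAL
WORDS ODD — THEOREMS AT an1's RECORD `symTablesAn1S2 3 Lc cΛ` UNDER THE PINS** (`Lc` odd, `2 ≤ N`, `cΛ·Lc⁴ = 2`, `cE = Lc^{3+1}`, `cVH = −Lc^{3+1}·½·Lc^{3+1}`,
`cE₂ = Lc⁸`, `cB = −Lc¹²∕4`, `Tc = (8N²)⁻¹ • wsym22 N`; `ξ = ½`, root `toSite (ctrOff 4 Lc)`, `cH l = (stepScale 3 Lc l · Lc^{3+1})⁻¹`).  The residual words are read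
off an2's slot-generic table laws (level `0`: the zero Wilson ∕ border remainders; level `m+1`: the `G′_m`-sandwiched `mm`-read of the kernel law's residual `Nr m`,
plus the zero border remainder), so (hTL)(hTL″) are identities; their parities come from `trK_GcombSh`, the class ∕ parity of `Nr` and `parityOdd_*`; the commutator
word's from (Sp).  Asserts NO value of any table; discharges NOTHING of the S-slot ∕ (C)^{ev}; NEVER «G-an2-4 closed» as (CONV-C). -/
theorem exists_tableLaws_parities_comb_three_at_pin (hLc : Odd Lc) {N : ℕ} (hN : 2 ≤ N) {cΛ cE cVH cE₂ cB : ℝ}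
    (hΛ : cΛ * (Lc : ℝ) ^ 4 = 2) (hcE : cE = (Lc : ℝ) ^ (3 + 1)) (hcVH : cVH = -((Lc : ℝ) ^ (3 + 1) * (1 / 2) * (Lc : ℝ) ^ (3 + 1)))
    (hcE₂ : cE₂ = (Lc : ℝ) ^ 8) (hcB : cB = -((Lc : ℝ) ^ 12 / 4)) {Tc : Fin 4 → Fin 4 → Fin 4 → Fin 4 → ℝ} (hTc : Tc = (8 * (N : ℝ) ^ 2)⁻¹ • wsym22 N) :
    ∃ R R'' : ℕ → (Fin (3 + 1) → ℤ) → Fin (3 + 1) → (Fin (3 + 1) → ℤ) → MKer (3 + 1) (Fib 3),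
      (∀ (l : ℕ) (Y : Fin (3 + 1) → ℤ) (κ' : Fin (3 + 1)) (u' : Fin (3 + 1) → ℤ),
        (stepScale 3 Lc l * (Lc : ℝ) ^ (3 + 1))⁻¹ • ∑ v ∈ box (3 + 1) Lc, divV (fun κ u => T2RecOf 3 Lc (GcombSh Lc) (SpureCombOf (symTablesAn1S2 3 Lc cΛ) cE cVH cΛ) (symTablesAn1S2 3 Lc cΛ).M cE₂ cB Tc (symTablesAn1S2 3 Lc cΛ).vh₂S (symTablesAn1S2 3 Lc cΛ).mixFF l κ u κ' u') ((Lc : ℤ) • Y + toSite v)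
          = comp (SpureCombOf (symTablesAn1S2 3 Lc cΛ) cE cVH cΛ l κ' u') (diagK ((1 / 2 : ℝ) • ∑ v ∈ box (3 + 1) Lc, legInd (toSite (ctrOff (3 + 1) Lc)) ((Lc : ℤ) • Y + toSite v))) - comp (diagK ((1 / 2 : ℝ) • ∑ v ∈ box (3 + 1) Lc, legInd (toSite (ctrOff (3 + 1) Lc)) ((Lc : ℤ) • Y + toSite v))) (SpureCombOf (symTablesAn1S2 3 Lc cΛ) cE cVH cΛ l κ' u') + R l Y κ' u') ∧
      (∀ (l : ℕ) (Y : Fin (3 + 1) → ℤ) (κ : Fin (3 + 1)) (u : Fin (3 + 1) → ℤ),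
        (stepScale 3 Lc l * (Lc : ℝ) ^ (3 + 1))⁻¹ • ∑ v ∈ box (3 + 1) Lc, divV (T2RecOf 3 Lc (GcombSh Lc) (SpureCombOf (symTablesAn1S2 3 Lc cΛ) cE cVH cΛ) (symTablesAn1S2 3 Lc cΛ).M cE₂ cB Tc (symTablesAn1S2 3 Lc cΛ).vh₂S (symTablesAn1S2 3 Lc cΛ).mixFF l κ u) ((Lc : ℤ) • Y + toSite v)
          = comp (SpureCombOf (symTablesAn1S2 3 Lc cΛ) cE cVH cΛ l κ u) (diagK ((1 / 2 : ℝ) • ∑ v ∈ box (3 + 1) Lc, legInd (toSite (ctrOff (3 + 1) Lc)) ((Lc : ℤ) • Y + toSite v))) - comp (diagK ((1 / 2 : ℝ) • ∑ v ∈ box (3 + 1) Lc, legInd (toSite (ctrOff (3 + 1) Lc)) ((Lc : ℤ) • Y + toSite v))) (SpureCombOf (symTablesAn1S2 3 Lc cΛ) cE cVH cΛ l κ u) + R'' l Y κ u) ∧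
      (∀ (l : ℕ) (Y : Fin (3 + 1) → ℤ) (κ : Fin (3 + 1)) (u : Fin (3 + 1) → ℤ),
        trK (comp (SpureCombOf (symTablesAn1S2 3 Lc cΛ) cE cVH cΛ l κ u) (diagK ((1 / 2 : ℝ) • ∑ v ∈ box (3 + 1) Lc, legInd (toSite (ctrOff (3 + 1) Lc)) ((Lc : ℤ) • Y + toSite v))) - comp (diagK ((1 / 2 : ℝ) • ∑ v ∈ box (3 + 1) Lc, legInd (toSite (ctrOff (3 + 1) Lc)) ((Lc : ℤ) • Y + toSite v))) (SpureCombOf (symTablesAn1S2 3 Lc cΛ) cE cVH cΛ l κ u)) = sgnK (comp (SpureCombOf (symTablesAn1S2 3 Lc cΛ) cE cVH cΛ l κ u) (diagK ((1 / 2 : ℝ) • ∑ v ∈ box (3 + 1) Lc, legInd (toSite (ctrOff (3 + 1) Lc)) ((Lc : ℤ) • Y + toSite v))) - comp (diagK ((1 / 2 : ℝ) • ∑ v ∈ box (3 + 1) Lc, legInd (toSite (ctrOff (3 + 1) Lc)) ((Lc : ℤ) • Y + toSite v))) (SpureCombOf (symTablesAn1S2 3 Lc cΛ) cE cVH cΛ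 l κ u))) ∧
      (∀ (l : ℕ) (Y : Fin (3 + 1) → ℤ) (κ : Fin (3 + 1)) (u : Fin (3 + 1) → ℤ), trK (R l Y κ u) = -sgnK (R l Y κ u)) ∧
      (∀ (l : ℕ) (Y : Fin (3 + 1) → ℤ) (κ : Fin (3 + 1)) (u : Fin (3 + 1) → ℤ), trK (R'' l Y κ u) = -sgnK (R'' l Y κ u)) := by
  have hLc1 : 1 ≤ Lc := one_le_of_neZero Lc
  have hr : ctrOff (3 + 1) Lc ∈ box (3 + 1) Lc := ctrOff_mem_box hLc1
  subst hcE hcVH hcE₂ hcB hTc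
  -- (V-d) of the record's border table from an1's (S-V)⁰⁴; (c1)′; (Sp)(Mp) from the table parities (V-p)(H-p)
  have hVd := (hVd_iff Lc (divV (symTablesAn1S2 3 Lc cΛ).V)).2 (divV_symVhSAt_eq_conjV_ctr (d := 3) hLc1)
  have hVp : ∀ (κ : Fin (3 + 1)) (u : Fin (3 + 1) → ℤ), trK ((symTablesAn1S2 3 Lc cΛ).V κ u) = -sgnK ((symTablesAn1S2 3 Lc cΛ).V κ u) :=
    fun κ u => trK_symVhSAt (d := 3) (ctr (3 + 1) Lc) Lc κ u
  have hHp : ∀ (μ : Fin (3 + 1)) (y : Fin (3 + 1) → ℤ), trK ((symTablesAn1S2 3 Lc cΛ).H μ y) = -sgnK ((symTablesAn1S2 3 Lc cΛ).H μ y) :=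
    fun μ y => trK_symHessFFAt (d := 3) (ctr (3 + 1) Lc) Lc μ y
  have hc1 : ∀ (j : ℕ) (κ : Fin (3 + 1)) (u : Fin (3 + 1) → ℤ),
      dM (GcombSh Lc j) Lc (SpureCombOf (symTablesAn1S2 3 Lc cΛ) ((Lc : ℝ) ^ (3 + 1)) (-((Lc : ℝ) ^ (3 + 1) * (1 / 2) * (Lc : ℝ) ^ (3 + 1))) cΛ j ) ((symTablesAn1S2 3 Lc cΛ).M j) κ u
        = vertexOfK (GcombSh Lc j) Lc (ScombOf (symTablesAn1S2 3 Lc cΛ) ((Lc : ℝ) ^ (3 + 1)) (-((Lc : ℝ) ^ (3 + 1) * (1 / 2) * (Lc : ℝ) ^ (3 + 1))) cΛ j) κ u :=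
    fun j κ u => dM_SpureCombOf_M1Of_eq_vertexOfK_ScombOf (d := 3) (symTablesAn1S2 3 Lc cΛ) _ _ cΛ j κ u
  have hSp : ∀ (j : ℕ) (κ : Fin (3 + 1)) (u : Fin (3 + 1) → ℤ),
      trK (SpureCombOf (symTablesAn1S2 3 Lc cΛ) ((Lc : ℝ) ^ (3 + 1)) (-((Lc : ℝ) ^ (3 + 1) * (1 / 2) * (Lc : ℝ) ^ (3 + 1))) cΛ j κ u) = -sgnK (SpureCombOf (symTablesAn1S2 3 Lc cΛ) ((Lc : ℝ) ^ (3 + 1)) (-((Lc : ℝ) ^ (3 + 1) * (1 / 2) * (Lc : ℝ) ^ (3 + 1))) cΛ j κ u) := fun j κ u => by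
    rw [SpureCombOf_eq]
    exact trK_SpureRecOf (d := 3) (symTablesAn1S2 3 Lc cΛ).hV (symTablesAn1S2 3 Lc cΛ).hH (decays_GcombSh Lc) (fun j' => trK_GcombSh (d := 3) (Lc := Lc) j') hVp hHp _ _ cΛ j κ u
  have hMp : ∀ (j : ℕ) (ρ : Fin (3 + 1)) (w : Fin (3 + 1) → ℤ), trK ((symTablesAn1S2 3 Lc cΛ).M j ρ w) = -sgnK ((symTablesAn1S2 3 Lc cΛ).M j ρ w) :=
    fun j ρ w => trK_M1Of (d := 3) (Lc := Lc) hHp cΛ j ρ w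
  -- an1's hW letter block at the two locks: classes (the zero Wilson ∕ border remainders, `symRMAn1`), parities, letters
  obtain ⟨C0, δ0, hδ0, hRBl, hRB''l, hRMl⟩ := hcls_sym (Lc := Lc) hLc1 cΛ 0
  have hC0 : 0 ≤ C0 := (hRMl 0 0 0).nonneg (Sum.inl 0)
  -- THE ALL-LEVELS KERNEL LAW OF `WcombOf tabs` WITH ITS RESIDUAL TOWER `Nr` (an2 g36), every socket a theorem at `G′`
  obtain ⟨Nr, hcls, hpar, hlaw⟩ := exists_kernelLaws_WcombOf_of_letters (d := 3) (symTablesAn1S2 3 Lc cΛ) hVd cΛ (-((Lc : ℝ) ^ 12 / 4)) (by norm_num : (((Lc : ℝ) ^ 8) : ℝ) = (Lc : ℝ) ^ (2 * (3 + 1)))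
    ((8 * (N : ℝ) ^ 2)⁻¹ • wsym22 N) hc1 hSp hMp
    ⟨C0, δ0, hδ0, locStencil_zero_apply hC0, locStencil_zero_apply hC0, hRBl, hRB''l, hRMl⟩ (fun j => hcls_sym (Lc := Lc) hLc1 cΛ (j + 1))
    (fun _ _ _ => parityOdd_zero) (fun _ _ _ => parityOdd_zero) hRBp_zero hRBp_zero (hRMp_sym_of_lock hΛ)
    (hWil_wilson_TW₃_su hN Lc (ctrOff (3 + 1) Lc) rfl) (hWil''_wilson_TW₃_su hN Lc (ctrOff (3 + 1) Lc) rfl)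
    (hBord0_sym hLc) (hBord0''_sym hLc) (hBordS_sym hLc) (hBordS''_sym hLc) (hM₂_sym cΛ)
  -- the residual's class as `Loc`, the resolvents' spread and sgn-symmetry
  have h𝒩 : ∀ (m : ℕ) (y : Fin (3 + 1) → ℤ) (ν : Fin (3 + 1)) (y' : Fin (3 + 1) → ℤ), Loc (Nr m y ν y') := fun m y ν y' => by
    obtain ⟨C, δ, hδ, h⟩ := hcls m
    exact ⟨_, _, _, δ, hδ, h y ν y'⟩
  have hKs : ∀ m : ℕ, Spr (GcombSh (d := 3) Lc m) := fun m => spr_of_decays (decays_GcombSh Lc m)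
  have hKt : ∀ m : ℕ, trK (GcombSh (d := 3) Lc m) = sgnK (GcombSh (d := 3) Lc m) := fun m => trK_GcombSh (d := 3) (Lc := Lc) m
  -- an2's SLOT-GENERIC TABLE LAWS at `G := GcombSh Lc`: level 0 from the Wilson + border letters, level m+1 from the level-m kernel law + the pinned lock + the border letter
  have hT0 : ∀ (Y : Fin (3 + 1) → ℤ) (κ' : Fin (3 + 1)) (u' : Fin (3 + 1) → ℤ),
      (stepScale 3 Lc 0 * (Lc : ℝ) ^ (3 + 1))⁻¹ • ∑ v ∈ box (3 + 1) Lc, divV (fun κ u => T2RecOf 3 Lc (GcombSh Lc) (SpureCombOf (symTablesAn1S2 3 Lc cΛ) ((Lc : ℝ) ^ (3 + 1)) (-((Lc : ℝ) ^ (3 + 1) * (1 / 2) * (Lc : ℝ) ^ (3 + 1))) cΛ) (symTablesAn1S2 3 Lc cΛ).M ((Lc : ℝ) ^ 8) (-((Lc : ℝ) ^ 12 / 4)) ((8 * (N : ℝ) ^ 2)⁻¹ • wsym22 N) (symTablesAn1S2 3 Lc cΛ).vh₂S (symTablesAn1S2 3 Lc cΛ).mixFF 0 κ u κ' u') ((Lc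 : ℤ) • Y + toSite v)
        = comp (SpureCombOf (symTablesAn1S2 3 Lc cΛ) ((Lc : ℝ) ^ (3 + 1)) (-((Lc : ℝ) ^ (3 + 1) * (1 / 2) * (Lc : ℝ) ^ (3 + 1))) cΛ 0 κ' u') (diagK ((1 / 2 : ℝ) • ∑ v ∈ box (3 + 1) Lc, legInd (toSite (ctrOff (3 + 1) Lc)) ((Lc : ℤ) • Y + toSite v))) - comp (diagK ((1 / 2 : ℝ) • ∑ v ∈ box (3 + 1) Lc, legInd (toSite (ctrOff (3 + 1) Lc)) ((Lc : ℤ) • Y + toSite v))) (SpureCombOf (symTablesAn1S2 3 Lc cΛ) ((Lc : ℝ) ^ (3 + 1)) (-((Lc : ℝ) ^ (3 + 1) * (1 / 2) * (Lc : ℝ) ^ (3 + 1))) cΛ 0 κ' u') + ((0 : (Fin 4 → ℤ) → Fin 4 → (Fin 4 → ℤ) → MKer (3 + 1) (Fib 3)) Y κ' u' + (0 : ℕ → (Fin 4 → ℤ) → Fin 4 → (Fin 4 → ℤ) → MKer 4 (Fib 3)) 0 Y κ' u') := fun Y κ' u' =>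
    tableLaw_T2RecOf_zero (d := 3) (Lc := Lc) (V := (symTablesAn1S2 3 Lc cΛ).V) (H := (symTablesAn1S2 3 Lc cΛ).H) (G := GcombSh Lc) (M := (symTablesAn1S2 3 Lc cΛ).M)
      ((Lc : ℝ) ^ (3 + 1)) (-((Lc : ℝ) ^ (3 + 1) * (1 / 2) * (Lc : ℝ) ^ (3 + 1))) cΛ ((Lc : ℝ) ^ 8) (-((Lc : ℝ) ^ 12 / 4)) ((8 * (N : ℝ) ^ 2)⁻¹ • wsym22 N) (symTablesAn1S2 3 Lc cΛ).vh₂S (symTablesAn1S2 3 Lc cΛ).mixFF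
      (hWil_wilson_TW₃_su hN Lc (ctrOff (3 + 1) Lc) rfl) (hBord0_sym hLc) Y κ' u'
  have hT0'' : ∀ (Y : Fin (3 + 1) → ℤ) (κ : Fin (3 + 1)) (u : Fin (3 + 1) → ℤ),
      (stepScale 3 Lc 0 * (Lc : ℝ) ^ (3 + 1))⁻¹ • ∑ v ∈ box (3 + 1) Lc, divV (T2RecOf 3 Lc (GcombSh Lc) (SpureCombOf (symTablesAn1S2 3 Lc cΛ) ((Lc : ℝ) ^ (3 + 1)) (-((Lc : ℝ) ^ (3 + 1) * (1 / 2) * (Lc : ℝ) ^ (3 + 1))) cΛ) (symTablesAn1S2 3 Lc cΛ).M ((Lc : ℝ) ^ 8) (-((Lc : ℝ) ^ 12 / 4)) ((8 * (N : ℝ) ^ 2)⁻¹ • wsym22 N) (symTablesAn1S2 3 Lc cΛ).vh₂S (symTablesAn1S2 3 Lc cΛ).mixFF 0 κ u) ((Lc : ℤ) • Y + toSite v)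
        = comp (SpureCombOf (symTablesAn1S2 3 Lc cΛ) ((Lc : ℝ) ^ (3 + 1)) (-((Lc : ℝ) ^ (3 + 1) * (1 / 2) * (Lc : ℝ) ^ (3 + 1))) cΛ 0 κ u) (diagK ((1 / 2 : ℝ) • ∑ v ∈ box (3 + 1) Lc, legInd (toSite (ctrOff (3 + 1) Lc)) ((Lc : ℤ) • Y + toSite v))) - comp (diagK ((1 / 2 : ℝ) • ∑ v ∈ box (3 + 1) Lc, legInd (toSite (ctrOff (3 + 1) Lc)) ((Lc : ℤ) • Y + toSite v))) (SpureCombOf (symTablesAn1S2 3 Lc cΛ) ((Lc : ℝ) ^ (3 + 1)) (-((Lc : ℝ) ^ (3 + 1) * (1 / 2) * (Lc : ℝ) ^ (3 + 1))) cΛ 0 κ u) + ((0 : (Fin 4 → ℤ) → Fin 4 → (Fin 4 → ℤ) → MKer (3 + 1) (Fib 3)) Y κ u + (0 : ℕ → (Fin 4 → ℤ) → Fin 4 → (Fin 4 → ℤ) → MKer 4 (Fib 3)) 0 Y κ u) := fun Y κ u =>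
    tableLaw_T2RecOf_zero'' (d := 3) (Lc := Lc) (V := (symTablesAn1S2 3 Lc cΛ).V) (H := (symTablesAn1S2 3 Lc cΛ).H) (G := GcombSh Lc) (M := (symTablesAn1S2 3 Lc cΛ).M)
      ((Lc : ℝ) ^ (3 + 1)) (-((Lc : ℝ) ^ (3 + 1) * (1 / 2) * (Lc : ℝ) ^ (3 + 1))) cΛ ((Lc : ℝ) ^ 8) (-((Lc : ℝ) ^ 12 / 4)) ((8 * (N : ℝ) ^ 2)⁻¹ • wsym22 N) (symTablesAn1S2 3 Lc cΛ).vh₂S (symTablesAn1S2 3 Lc cΛ).mixFF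
      (hWil''_wilson_TW₃_su hN Lc (ctrOff (3 + 1) Lc) rfl) (hBord0''_sym hLc) Y κ u
  have hTS : ∀ (m : ℕ) (Y : Fin (3 + 1) → ℤ) (κ' : Fin (3 + 1)) (u' : Fin (3 + 1) → ℤ),
      (stepScale 3 Lc (m + 1) * (Lc : ℝ) ^ (3 + 1))⁻¹ • ∑ v ∈ box (3 + 1) Lc, divV (fun κ u => T2RecOf 3 Lc (GcombSh Lc) (SpureCombOf (symTablesAn1S2 3 Lc cΛ) ((Lc : ℝ) ^ (3 + 1)) (-((Lc : ℝ) ^ (3 + 1) * (1 / 2) * (Lc : ℝ) ^ (3 + 1))) cΛ) (symTablesAn1S2 3 Lc cΛ).M ((Lc : ℝ) ^ 8) (-((Lc : ℝ) ^ 12 / 4)) ((8 * (N : ℝ) ^ 2)⁻¹ • wsym22 N) (symTablesAn1S2 3 Lc cΛ).vh₂S (symTablesAn1S2 3 Lc cΛ).mixFF (m + 1) κ u κ' u') ((Lc : ℤ) • Y + toSite v)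
        = comp (SpureCombOf (symTablesAn1S2 3 Lc cΛ) ((Lc : ℝ) ^ (3 + 1)) (-((Lc : ℝ) ^ (3 + 1) * (1 / 2) * (Lc : ℝ) ^ (3 + 1))) cΛ (m + 1) κ' u') (diagK ((1 / 2 : ℝ) • ∑ v ∈ box (3 + 1) Lc, legInd (toSite (ctrOff (3 + 1) Lc)) ((Lc : ℤ) • Y + toSite v))) - comp (diagK ((1 / 2 : ℝ) • ∑ v ∈ box (3 + 1) Lc, legInd (toSite (ctrOff (3 + 1) Lc)) ((Lc : ℤ) • Y + toSite v))) (SpureCombOf (symTablesAn1S2 3 Lc cΛ) ((Lc : ℝ) ^ (3 + 1)) (-((Lc : ℝ) ^ (3 + 1) * (1 / 2) * (Lc : ℝ) ^ (3 + 1))) cΛ (m + 1) κ' u')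
          + ((-((stepScale 3 Lc (m + 1) * (Lc : ℝ) ^ (3 + 1))⁻¹ * (((Lc : ℝ) ^ 8) * wV4 3 Lc (m + 1)))) • ∑ v ∈ box (3 + 1) Lc,
              mmRead Lc (comp (comp (GcombSh Lc m) (Nr m ((Lc : ℤ) • Y + toSite v) κ' u')) (GcombSh Lc m))
            + (0 : ℕ → (Fin 4 → ℤ) → Fin 4 → (Fin 4 → ℤ) → MKer 4 (Fib 3)) (m + 1) Y κ' u') := fun m Y κ' u' =>
    tableLaw_T2RecOf_succ (d := 3) (Lc := Lc) (V := (symTablesAn1S2 3 Lc cΛ).V) (H := (symTablesAn1S2 3 Lc cΛ).H) (G := GcombSh Lc) (M := (symTablesAn1S2 3 Lc cΛ).M) hLc1 (symTablesAn1S2 3 Lc cΛ).hV (symTablesAn1S2 3 Lc cΛ).hH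
      (decays_GcombSh Lc) (symTablesAn1S2 3 Lc cΛ).hM ((Lc : ℝ) ^ (3 + 1)) (-((Lc : ℝ) ^ (3 + 1) * (1 / 2) * (Lc : ℝ) ^ (3 + 1))) cΛ ((Lc : ℝ) ^ 8) (-((Lc : ℝ) ^ 12 / 4)) ((8 * (N : ℝ) ^ 2)⁻¹ • wsym22 N) (symTablesAn1S2 3 Lc cΛ).hB (symTablesAn1S2 3 Lc cΛ).hmix m
      (spr_bhKStepSh (spr_Dsh hLc1) m) (spr_axEc _ _) (relInv_coDressKAt_Gsym_bhKStepSh (d := 3) (Lc := Lc) m) hr (1 / 2 : ℝ)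
      (fun y => comp_axEc_diagK_comm _ _ _) (fun y => divV_dM_SpureCombOf_eq_conjV (symTablesAn1S2 3 Lc cΛ) hVd cΛ m y) (hc1 m) (h𝒩 m) (hlaw m)
      (lock_pin_three (Lc := Lc) m) (hBordS_sym hLc m) Y κ' u'
  have hTS'' : ∀ (m : ℕ) (Y : Fin (3 + 1) → ℤ) (κ : Fin (3 + 1)) (u : Fin (3 + 1) → ℤ),
      (stepScale 3 Lc (m + 1) * (Lc : ℝ) ^ (3 + 1))⁻¹ • ∑ v ∈ box (3 + 1) Lc, divV (T2RecOf 3 Lc (GcombSh Lc) (SpureCombOf (symTablesAn1S2 3 Lc cΛ) ((Lc : ℝ) ^ (3 + 1)) (-((Lc : ℝ) ^ (3 + 1) * (1 / 2) * (Lc : ℝ) ^ (3 + 1))) cΛ) (symTablesAn1S2 3 Lc cΛ).M ((Lc : ℝ) ^ 8) (-((Lc : ℝ) ^ 12 / 4)) ((8 * (N : ℝ) ^ 2)⁻¹ • wsym22 N) (symTablesAn1S2 3 Lc cΛ).vh₂S (symTablesAn1S2 3 Lc cΛ).mixFF (m + 1) κ u) ((Lc : ℤ) • Y + toSite v)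
        = comp (SpureCombOf (symTablesAn1S2 3 Lc cΛ) ((Lc : ℝ) ^ (3 + 1)) (-((Lc : ℝ) ^ (3 + 1) * (1 / 2) * (Lc : ℝ) ^ (3 + 1))) cΛ (m + 1) κ u) (diagK ((1 / 2 : ℝ) • ∑ v ∈ box (3 + 1) Lc, legInd (toSite (ctrOff (3 + 1) Lc)) ((Lc : ℤ) • Y + toSite v))) - comp (diagK ((1 / 2 : ℝ) • ∑ v ∈ box (3 + 1) Lc, legInd (toSite (ctrOff (3 + 1) Lc)) ((Lc : ℤ) • Y + toSite v))) (SpureCombOf (symTablesAn1S2 3 Lc cΛ) ((Lc : ℝ) ^ (3 + 1)) (-((Lc : ℝ) ^ (3 + 1) * (1 / 2) * (Lc : ℝ) ^ (3 + 1))) cΛ (m + 1) κ u)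
          + ((-((stepScale 3 Lc (m + 1) * (Lc : ℝ) ^ (3 + 1))⁻¹ * (((Lc : ℝ) ^ 8) * wV4 3 Lc (m + 1)))) • ∑ v ∈ box (3 + 1) Lc,
              mmRead Lc (comp (comp (GcombSh Lc m) (Nr m ((Lc : ℤ) • Y + toSite v) κ u)) (GcombSh Lc m))
            + (0 : ℕ → (Fin 4 → ℤ) → Fin 4 → (Fin 4 → ℤ) → MKer 4 (Fib 3)) (m + 1) Y κ u) := fun m Y κ u =>
    tableLaw_T2RecOf_succ'' (d := 3) (Lc := Lc) (V := (symTablesAn1S2 3 Lc cΛ).V) (H := (symTablesAn1S2 3 Lc cΛ).H) (G := GcombSh Lc) (M := (symTablesAn1S2 3 Lc cΛ).M) hLc1 (symTablesAn1S2 3 Lc cΛ).hV (symTablesAn1S2 3 Lc cΛ).hH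
      (decays_GcombSh Lc) (symTablesAn1S2 3 Lc cΛ).hM ((Lc : ℝ) ^ (3 + 1)) (-((Lc : ℝ) ^ (3 + 1) * (1 / 2) * (Lc : ℝ) ^ (3 + 1))) cΛ ((Lc : ℝ) ^ 8) (-((Lc : ℝ) ^ 12 / 4)) ((8 * (N : ℝ) ^ 2)⁻¹ • wsym22 N) (symTablesAn1S2 3 Lc cΛ).hB (symTablesAn1S2 3 Lc cΛ).hmix m
      (spr_bhKStepSh (spr_Dsh hLc1) m) (spr_axEc _ _) (relInv_coDressKAt_Gsym_bhKStepSh (d := 3) (Lc := Lc) m) hr (1 / 2 : ℝ)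
      (fun y => comp_axEc_diagK_comm _ _ _) (fun y => divV_dM_SpureCombOf_eq_conjV (symTablesAn1S2 3 Lc cΛ) hVd cΛ m y) (hc1 m) (h𝒩 m) (hlaw m)
      (lock_pin_three (Lc := Lc) m) (hBordS''_sym hLc m) Y κ u
  -- the residual words := (law's left side) − (commutator word); the laws are then identities and the parities are read off level by level
  refine ⟨fun l Y κ' u' => (stepScale 3 Lc l * (Lc : ℝ) ^ (3 + 1))⁻¹ • ∑ v ∈ box (3 + 1) Lc, divV (fun κ u => T2RecOf 3 Lc (GcombSh Lc) (SpureCombOf (symTablesAn1S2 3 Lc cΛ) ((Lc : ℝ) ^ (3 + 1)) (-((Lc : ℝ) ^ (3 + 1) * (1 / 2) * (Lc : ℝ) ^ (3 + 1))) cΛ) (symTablesAn1S2 3 Lc cΛ).M ((Lc : ℝ) ^ 8) (-((Lc : ℝ) ^ 12 / 4)) ((8 * (N : ℝ) ^ 2)⁻¹ • wsym22 N) (symTablesAn1S2 3 Lc cΛ).vh₂S (symTablesAn1S2 3 Lc cΛ).mixFF l κ u κ' u') ((Lc : ℤ) • Y + toSite v)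
      - (comp (SpureCombOf (symTablesAn1S2 3 Lc cΛ) ((Lc : ℝ) ^ (3 + 1)) (-((Lc : ℝ) ^ (3 + 1) * (1 / 2) * (Lc : ℝ) ^ (3 + 1))) cΛ l κ' u') (diagK ((1 / 2 : ℝ) • ∑ v ∈ box (3 + 1) Lc, legInd (toSite (ctrOff (3 + 1) Lc)) ((Lc : ℤ) • Y + toSite v))) - comp (diagK ((1 / 2 : ℝ) • ∑ v ∈ box (3 + 1) Lc, legInd (toSite (ctrOff (3 + 1) Lc)) ((Lc : ℤ) • Y + toSite v))) (SpureCombOf (symTablesAn1S2 3 Lc cΛ) ((Lc : ℝ) ^ (3 + 1)) (-((Lc : ℝ) ^ (3 + 1) * (1 / 2) * (Lc : ℝ) ^ (3 + 1))) cΛ l κ' u')),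
    fun l Y κ u => (stepScale 3 Lc l * (Lc : ℝ) ^ (3 + 1))⁻¹ • ∑ v ∈ box (3 + 1) Lc, divV (T2RecOf 3 Lc (GcombSh Lc) (SpureCombOf (symTablesAn1S2 3 Lc cΛ) ((Lc : ℝ) ^ (3 + 1)) (-((Lc : ℝ) ^ (3 + 1) * (1 / 2) * (Lc : ℝ) ^ (3 + 1))) cΛ) (symTablesAn1S2 3 Lc cΛ).M ((Lc : ℝ) ^ 8) (-((Lc : ℝ) ^ 12 / 4)) ((8 * (N : ℝ) ^ 2)⁻¹ • wsym22 N) (symTablesAn1S2 3 Lc cΛ).vh₂S (symTablesAn1S2 3 Lc cΛ).mixFF l κ u) ((Lc : ℤ) • Y + toSite v)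
      - (comp (SpureCombOf (symTablesAn1S2 3 Lc cΛ) ((Lc : ℝ) ^ (3 + 1)) (-((Lc : ℝ) ^ (3 + 1) * (1 / 2) * (Lc : ℝ) ^ (3 + 1))) cΛ l κ u) (diagK ((1 / 2 : ℝ) • ∑ v ∈ box (3 + 1) Lc, legInd (toSite (ctrOff (3 + 1) Lc)) ((Lc : ℤ) • Y + toSite v))) - comp (diagK ((1 / 2 : ℝ) • ∑ v ∈ box (3 + 1) Lc, legInd (toSite (ctrOff (3 + 1) Lc)) ((Lc : ℤ) • Y + toSite v))) (SpureCombOf (symTablesAn1S2 3 Lc cΛ) ((Lc : ℝ) ^ (3 + 1)) (-((Lc : ℝ) ^ (3 + 1) * (1 / 2) * (Lc : ℝ) ^ (3 + 1))) cΛ l κ u)),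
    fun l Y κ' u' => (add_sub_cancel _ _).symm, fun l Y κ u => (add_sub_cancel _ _).symm,
    fun l Y κ u => parityEven_comm_of_oddRows (hSp l)
      (fun Y' => (1 / 2 : ℝ) • ∑ v ∈ box (3 + 1) Lc, legInd (toSite (ctrOff (3 + 1) Lc)) ((Lc : ℤ) • Y' + toSite v)) Y κ u, ?_, ?_⟩
  · intro l Y κ' u'
    cases l with
    | zero =>
      simp only [hT0 Y κ' u', add_sub_cancel_left]
      exact parityOdd_add parityOdd_zero (hRBp_zero 0 Y κ' u')
    | succ m =>
      simp only [hTS m Y κ' u', add_sub_cancel_left]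
      exact parityOdd_add (parityOdd_smul _ (parityOdd_sum _ fun v _ =>
        parityOdd_mmRead Lc (parityOdd_sandwich (hKs m) (h𝒩 m _ κ' u') (hKt m) (hpar m _ κ' u')))) (hRBp_zero (m + 1) Y κ' u')
  · intro l Y κ u
    cases l with
    | zero =>
      simp only [hT0'' Y κ u, add_sub_cancel_left]
      exact parityOdd_add parityOdd_zero (hRBp_zero 0 Y κ u)
    | succ m =>
      simp only [hTS'' m Y κ u, add_sub_cancel_left]
      exact parityOdd_add (parityOdd_smul _ (parityOdd_sum _ fun v _ =>
        parityOdd_mmRead Lc (parityOdd_sandwich (hKs m) (h𝒩 m _ κ u) (hKt m) (hpar m _ κ u)))) (hRBp_zero (m + 1) Y κ u)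

end Summit.QuantumFields.BalabanUV.Beta.GAN24.CombTableLawsAtPin

end
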